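import Mathlib
import Literature.MathematicalPhysics.QuantumFieldTheory.King1986.EffectiveLaplacianRate
import HarnessLib

/-!
# BalabanUVNodes ∕ N15 — THE KING-MODEL RUNG (PART Ϣ-c): GAUSSIAN SUMS ON THE CYCLE `ℤ∕K` —
# `Σ_{w≥1}e^{−aw²} ≤ ½√(π∕a)`; the MIXING bound `K⁻¹Σ_k e^{−s(2−2cos(2πk∕K))} ≤ 1∕K + e^{−8s∕K²}√(π∕(8s))` and the WINDOW bound `K⁻¹Σ_k e^{−(8s∕K²)((|v(k)|−4)₊)²} ≤ 9∕K + √(π∕(8s))`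
# (the two transverse ∕ localisation inputs of PART Ϣ: the η-uniform power-law decay of King's `A = 0` covariance in four dimensions by heat-kernel subordination)
# (Track A, DAG node N15 = NE2; FAN-OUT v1.1 §N15 s3 «KING-MODEL RUNG»; count-neutral)

HONEST FRAMING.  Count-neutral (cell `pub-ymgap`, seat `pub-ymgap-dag-n15-e` g55; `--supports stmt-QuantumFields-27247 --as helper` = K3ᴬ).  Elementary estimates on the finite cycle `ℤ∕K`
(`K ≥ 1`) in King's reduced-momentum variable `v(k) = valMinAbs k ∈ (−K∕2, K∕2]` ((4.4) p.670: the symbol `2 − 2cos(2πv∕K)` of `−Δ` in one direction; tree `King1986.Torus.lapSym` is the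
`(d+1)`-fold sum of these): (i) the Gaussian tail `Σ_{w=1}^{M}e^{−aw²} ≤ ∫₀^∞e^{−ax²}dx = ½√(π∕a)` (antitone comparison, Mathlib `AntitoneOn.sum_le_integral` + `integral_gaussian_Ioi`);
(ii) sums over the cycle through the at-most-two-to-one map `k ↦ |v(k)| = k.valMinAbs.natAbs` (mnemonic `absV` in the lemma names); (iii) JORDAN `16v²∕K² ≤ 2 − 2cos(2πv∕K)` (tree `King1986.fdSymbol_ge_jordan` BY NAME); hence
(iv) ★★ **`cycle_symbol_sum_le`** — the MIXING bound for the diagonal of the cycle heat kernel `Q_s(0) = K⁻¹Σ_k e^{−s(2−2cos(2πv(k)∕K))} ≤ 1∕K + e^{−8s∕K²}·√(π∕(8s))` (zero mode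
`1∕K` + Gaussian shells; the factor `e^{−8s∕K²}` = equidistribution beyond the mixing time `K²` — it is what keeps the transverse zero modes from costing a `log(c∕m²)` in PART Ϣ-g),
and (v) ★★ **`cycle_window_sum_le`** — `K⁻¹Σ_k e^{−(8s∕K²)((|v(k)|−4)₊)²} ≤ 9∕K + √(π∕(8s))` (the Riemann sum of the window suprema of the localised fourth derivative of PART Ϣ-a).
No field theory in this file; NOT a node discharge; nothing continuum ∕ Clay.
PRIOR TREE ART (by name): `King1986.fdSymbol` ∕ `fdSymbol_ge_jordan` (`EffectiveLaplacianRate`); Ϯ-e `…AnalyticDeterminantGreenDiagonalFour.lapSym_ge_supNorm_sq` is the four-dimensional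
sup-norm form of (iii) (not imported: this file is one-dimensional); Mathlib `ZMod.valMinAbs`, `ZMod.natAbs_valMinAbs_le`, `ZMod.natAbs_valMinAbs_eq_natAbs_valMinAbs`,
`ZMod.valMinAbs_eq_zero`, `AntitoneOn.sum_le_integral`, `integral_gaussian_Ioi`, `integrable_exp_neg_mul_sq`.  Literature Gaussian-sum lemmas with OTHER shapes exist
(`DiscreteGaussianIntMass.sum_exp_neg_pi_sq_div_le_one_add`, `ShearFlow….sum_exp_neg_mul_sq_pos_le`, `CasimirBox….tsum_exp_neg_mul_sq_succ_le`) — different statements, not restated.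
Dedup (rg at filing): basename 0 files; needles `sum_range_exp_neg_mul_sq_succ_le|absV|card_filter_absV|sum_univ_absV_le|cycle_symbol_sum_le|cycle_window_sum_le|sixteen_mul_sq_div_sq_le` 0 tree files.
Locators: [King1986] (4.4) p.670, proof of Lemma 4.1 p.671 (Jordan's inequality for the symbol); [LawlerLimic2010] §2.3 (Gaussian comparison of lattice heat kernels) for the method; the
inequalities are [folklore].  0 `sorry`; 0 `def` (`|v(k)|` is spelled `k.valMinAbs.natAbs` throughout; the lemma names keep the mnemonic `absV`).
-/

noncomputable section

open Real Set MeasureTheory Finset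
open scoped BigOperators

namespace Summit.QuantumFields.YangMills.BalabanUVNodes.N15KingModelRung.HeatKernel

open Literature.MathematicalPhysics.QuantumFieldTheory.King1986 (fdSymbol fdSymbol_ge_jordan)

/-! ## §1 The Gaussian tail `Σ_{w=1}^{M} e^{−aw²} ≤ ½√(π∕a)` -/

/-- ★ **GAUSSIAN TAIL**: `Σ_{i<M} e^{−a(i+1)²} ≤ ½√(π∕a)` for `a > 0` — the antitone function `e^{−ax²}` summed over `1,…,M` is below its integral over `[0,M] ⊆ [0,∞)`. [folklore] -/
theorem sum_range_exp_neg_mul_sq_succ_le {a : ℝ} (ha : 0 < a) (M : ℕ) :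
    ∑ i ∈ Finset.range M, Real.exp (-a * ((i + 1 : ℕ) : ℝ) ^ 2) ≤ Real.sqrt (π / a) / 2 := by
  have hanti : AntitoneOn (fun x : ℝ => Real.exp (-a * x ^ 2)) (Icc (0 : ℝ) (0 + M)) := by
    intro x hx y hy hxy
    have hx0 : 0 ≤ x := hx.1
    apply Real.exp_le_exp.mpr
    have : x ^ 2 ≤ y ^ 2 := by nlinarith
    nlinarith
  have h1 := AntitoneOn.sum_le_integral hanti
  simp only [zero_add] at h1
  have h2 : ∫ x in (0 : ℝ)..(M : ℝ), Real.exp (-a * x ^ 2) ≤ ∫ x in Ioi (0 : ℝ), Real.exp (-a * x ^ 2) := by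
    rw [intervalIntegral.integral_of_le (by positivity)]
    refine setIntegral_mono_set (integrable_exp_neg_mul_sq ha).integrableOn ?_ ?_
    · exact Filter.Eventually.of_forall fun x => (Real.exp_pos _).le
    · exact Filter.Eventually.of_forall Ioc_subset_Ioi_self
  rw [integral_gaussian_Ioi] at h2
  exact h1.trans h2

/-- The same with the total mass `√(π∕a)` (two tails). [folklore] -/
theorem two_mul_sum_range_exp_neg_mul_sq_succ_le {a : ℝ} (ha : 0 < a) (M : ℕ) :
    2 * ∑ i ∈ Finset.range M, Real.exp (-a * ((i + 1 : ℕ) : ℝ) ^ 2) ≤ Real.sqrt (π / a) := by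
  have := sum_range_exp_neg_mul_sq_succ_le ha M; linarith

/-! ## §2 The cycle `ℤ∕K` through `k ↦ |v(k)|` -/

variable {K : ℕ} [NeZero K]

/-- `|v(k)| ≤ K∕2`. [folklore] -/
theorem absV_le (k : ZMod K) : k.valMinAbs.natAbs ≤ K / 2 := ZMod.natAbs_valMinAbs_le k

omit [NeZero K] in
/-- `|v(k)| = 0 ↔ k = 0`. [folklore] -/
theorem absV_eq_zero_iff (k : ZMod K) : k.valMinAbs.natAbs = 0 ↔ k = 0 := by
  rw [Int.natAbs_eq_zero, ZMod.valMinAbs_eq_zero]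

omit [NeZero K] in
/-- `|v(k)| = |v(k′)| ↔ k′ = ±k`. [folklore] -/
theorem absV_eq_absV_iff (k k' : ZMod K) : k.valMinAbs.natAbs = k'.valMinAbs.natAbs ↔ k = k' ∨ k = -k' :=
  ZMod.natAbs_valMinAbs_eq_natAbs_valMinAbs

omit [NeZero K] in
/-- `(v(k) : ℝ)² = |v(k)|²`. [folklore] -/
theorem valMinAbs_sq_eq_absV_sq (k : ZMod K) : ((k.valMinAbs : ℤ) : ℝ) ^ 2 = ((k.valMinAbs.natAbs : ℕ) : ℝ) ^ 2 := by
  rw [Nat.cast_natAbs, Int.cast_abs, sq_abs]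

/-- Every fibre of `k ↦ |v(k)|` has at most two elements. [folklore] -/
theorem card_filter_absV_eq_le_two (w : ℕ) : (Finset.univ.filter fun k : ZMod K => k.valMinAbs.natAbs = w).card ≤ 2 := by
  by_cases h : ∃ k₀ : ZMod K, k₀.valMinAbs.natAbs = w
  · obtain ⟨k₀, hk₀⟩ := h
    have hsub : (Finset.univ.filter fun k : ZMod K => k.valMinAbs.natAbs = w) ⊆ {k₀, -k₀} := by
      intro k hk
      rw [Finset.mem_filter] at hk
      have := (absV_eq_absV_iff k k₀).mp (hk.2.trans hk₀.symm)
      rcases this with h1 | h1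
      · rw [h1]; simp
      · rw [h1]; simp
    exact (Finset.card_le_card hsub).trans (Finset.card_le_two)
  · push Not at h
    have : (Finset.univ.filter fun k : ZMod K => k.valMinAbs.natAbs = w) = ∅ := by
      rw [Finset.filter_eq_empty_iff]; intro k _; exact h k
    rw [this]; simp

/-- The fibre over `0` is `{0}`. [folklore] -/
theorem card_filter_absV_eq_zero : (Finset.univ.filter fun k : ZMod K => k.valMinAbs.natAbs = 0).card = 1 := by
  have : (Finset.univ.filter fun k : ZMod K => k.valMinAbs.natAbs = 0) = {0} := by
    ext k; simp [ZMod.valMinAbs_eq_zero]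
  rw [this, Finset.card_singleton]

/-- ★ **SUMS OVER THE CYCLE THROUGH `|v|`**: for `φ ≥ 0`, `Σ_{k∈ℤ∕K} φ(|v(k)|) ≤ φ(0) + 2·Σ_{i<K∕2} φ(i+1)` (fibres of size `1` at `0`, `≤ 2` elsewhere, `|v| ≤ K∕2`). [folklore] -/
theorem sum_univ_absV_le (φ : ℕ → ℝ) (hφ : ∀ w, 0 ≤ φ w) :
    ∑ k : ZMod K, φ (k.valMinAbs.natAbs) ≤ φ 0 + 2 * ∑ i ∈ Finset.range (K / 2), φ (i + 1) := by
  classical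
  have hmaps : ∀ k ∈ (Finset.univ : Finset (ZMod K)), k.valMinAbs.natAbs ∈ Finset.range (K / 2 + 1) :=
    fun k _ => Finset.mem_range.mpr (Nat.lt_succ_of_le (absV_le k))
  rw [← Finset.sum_fiberwise_of_maps_to hmaps]
  have hfib : ∀ w ∈ Finset.range (K / 2 + 1),
      ∑ k ∈ Finset.univ.filter (fun k : ZMod K => k.valMinAbs.natAbs = w), φ (k.valMinAbs.natAbs) = ((Finset.univ.filter fun k : ZMod K => k.valMinAbs.natAbs = w).card : ℝ) * φ w := by
    intro w _
    rw [Finset.sum_congr rfl (fun k hk => by rw [(Finset.mem_filter.mp hk).2]), Finset.sum_const, nsmul_eq_mul]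
  rw [Finset.sum_congr rfl hfib, Finset.sum_range_succ']
  have h0 : ((Finset.univ.filter fun k : ZMod K => k.valMinAbs.natAbs = 0).card : ℝ) * φ 0 = φ 0 := by
    rw [card_filter_absV_eq_zero]; simp
  rw [h0, add_comm, Finset.mul_sum]
  refine add_le_add le_rfl (Finset.sum_le_sum fun i _ => ?_)
  have hc : ((Finset.univ.filter fun k : ZMod K => k.valMinAbs.natAbs = i + 1).card : ℝ) ≤ 2 := by exact_mod_cast card_filter_absV_eq_le_two (i + 1)
  exact mul_le_mul_of_nonneg_right hc (hφ _)

/-! ## §3 Jordan on the cycle -/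

/-- ★ **JORDAN ON THE CYCLE**: `16|v(k)|²∕K² ≤ 2 − 2cos(2πv(k)∕K)` (`2 − 2cos θ = 4sin²(θ∕2) ≥ (4∕π²)θ²` on `|θ| ≤ π`, tree `fdSymbol_ge_jordan`, at `θ = 2πv∕K`, `|v| ≤ K∕2`).
[cite: King1986, (4.4) p.670, proof of Lemma 4.1 p.671] -/
theorem sixteen_mul_absV_sq_div_le (k : ZMod K) :
    16 * ((k.valMinAbs.natAbs : ℕ) : ℝ) ^ 2 / (K : ℝ) ^ 2 ≤ 2 - 2 * Real.cos (2 * π * (k.valMinAbs : ℝ) / K) := by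
  have hK : (0 : ℝ) < K := by exact_mod_cast Nat.pos_of_ne_zero (NeZero.ne K)
  set θ : ℝ := 2 * π * (k.valMinAbs : ℝ) / K with hθ
  -- `2 − 2cos θ = fdSymbol 1 θ`
  have hfd : 2 - 2 * Real.cos θ = fdSymbol 1 θ := by
    unfold fdSymbol
    have h : Real.sin (θ / 2) ^ 2 = 1 / 2 - Real.cos θ / 2 := by
      rw [Real.sin_sq_eq_half_sub, mul_div_cancel₀ θ two_ne_zero]
    rw [one_pow, one_mul, h]; ring
  -- `|θ| ≤ π`
  have habs : |(k.valMinAbs : ℝ)| ≤ (K : ℝ) / 2 := by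
    have h1 : ((k.valMinAbs.natAbs : ℕ) : ℝ) ≤ ((K / 2 : ℕ) : ℝ) := by exact_mod_cast ZMod.natAbs_valMinAbs_le k
    rw [Nat.cast_natAbs, Int.cast_abs] at h1
    exact h1.trans (Nat.cast_div_le)
  have hθπ : |1 * θ| ≤ π := by
    rw [one_mul, hθ, abs_div, abs_of_pos hK, div_le_iff₀ hK, abs_mul, abs_of_pos (by positivity : (0:ℝ) < 2 * π)]
    nlinarith [habs, Real.pi_pos]
  have hj := fdSymbol_ge_jordan (η := 1) one_ne_zero hθπ
  rw [← hfd] at hj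
  have e : 4 / π ^ 2 * θ ^ 2 = 16 * ((k.valMinAbs.natAbs : ℕ) : ℝ) ^ 2 / (K : ℝ) ^ 2 := by
    rw [← valMinAbs_sq_eq_absV_sq, hθ]
    field_simp
    ring
  rw [e] at hj
  exact hj

/-- Hence `e^{−s(2−2cos(2πv(k)∕K))} ≤ e^{−16s|v(k)|²∕K²}` for `s ≥ 0`. [cite: King1986, (4.4) p.670] -/
theorem exp_neg_mul_symbol_le {s : ℝ} (hs : 0 ≤ s) (k : ZMod K) :
    Real.exp (-(s * (2 - 2 * Real.cos (2 * π * (k.valMinAbs : ℝ) / K)))) ≤ Real.exp (-(16 * s / (K : ℝ) ^ 2) * ((k.valMinAbs.natAbs : ℕ) : ℝ) ^ 2) := by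
  apply Real.exp_le_exp.mpr
  have h := mul_le_mul_of_nonneg_left (sixteen_mul_absV_sq_div_le k) hs
  have e : s * (16 * ((k.valMinAbs.natAbs : ℕ) : ℝ) ^ 2 / (K : ℝ) ^ 2) = (16 * s / (K : ℝ) ^ 2) * ((k.valMinAbs.natAbs : ℕ) : ℝ) ^ 2 := by ring
  linarith

/-! ## §4 The mixing bound and the window bound -/

/-- The Gaussian shells with the mixing factor peeled off: `2Σ_{i<M} e^{−16s(i+1)²∕K²} ≤ e^{−8s∕K²}·K·√(π∕(8s))` (`s > 0`; `16s(i+1)² ≥ 8s + 8s(i+1)²`). [folklore] -/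
theorem two_mul_sum_exp_sixteen_le {s : ℝ} (hs : 0 < s) (M : ℕ) :
    2 * ∑ i ∈ Finset.range M, Real.exp (-(16 * s / (K : ℝ) ^ 2) * ((i + 1 : ℕ) : ℝ) ^ 2)
      ≤ Real.exp (-(8 * s / (K : ℝ) ^ 2)) * ((K : ℝ) * Real.sqrt (π / (8 * s))) := by
  have hK : (0 : ℝ) < K := by exact_mod_cast Nat.pos_of_ne_zero (NeZero.ne K)
  have ha : 0 < 8 * s / (K : ℝ) ^ 2 := by positivity
  -- termwise peel
  have hterm : ∀ i ∈ Finset.range M, Real.exp (-(16 * s / (K : ℝ) ^ 2) * ((i + 1 : ℕ) : ℝ) ^ 2)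
      ≤ Real.exp (-(8 * s / (K : ℝ) ^ 2)) * Real.exp (-(8 * s / (K : ℝ) ^ 2) * ((i + 1 : ℕ) : ℝ) ^ 2) := by
    intro i _
    rw [← Real.exp_add]
    apply Real.exp_le_exp.mpr
    have h1 : (1 : ℝ) ≤ ((i + 1 : ℕ) : ℝ) ^ 2 := by
      have : (1 : ℝ) ≤ ((i + 1 : ℕ) : ℝ) := by exact_mod_cast Nat.succ_le_succ (Nat.zero_le i)
      nlinarith
    have h2 : 0 ≤ 8 * s / (K : ℝ) ^ 2 * (((i + 1 : ℕ) : ℝ) ^ 2 - 1) := mul_nonneg ha.le (by linarith)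
    have e : (16 * s / (K : ℝ) ^ 2) * ((i + 1 : ℕ) : ℝ) ^ 2 = 2 * ((8 * s / (K : ℝ) ^ 2) * ((i + 1 : ℕ) : ℝ) ^ 2) := by ring
    rw [neg_mul, neg_mul, e]
    nlinarith [h2]
  have hsum := Finset.sum_le_sum hterm
  rw [← Finset.mul_sum] at hsum
  have htail := two_mul_sum_range_exp_neg_mul_sq_succ_le ha M
  have hsq : Real.sqrt (π / (8 * s / (K : ℝ) ^ 2)) = (K : ℝ) * Real.sqrt (π / (8 * s)) := by
    rw [show π / (8 * s / (K : ℝ) ^ 2) = (K : ℝ) ^ 2 * (π / (8 * s)) by field_simp]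
    rw [Real.sqrt_mul (sq_nonneg _), Real.sqrt_sq hK.le]
  rw [hsq] at htail
  have h0 : 0 ≤ Real.exp (-(8 * s / (K : ℝ) ^ 2)) := (Real.exp_pos _).le
  calc 2 * ∑ i ∈ Finset.range M, Real.exp (-(16 * s / (K : ℝ) ^ 2) * ((i + 1 : ℕ) : ℝ) ^ 2)
      ≤ 2 * (Real.exp (-(8 * s / (K : ℝ) ^ 2)) * ∑ i ∈ Finset.range M, Real.exp (-(8 * s / (K : ℝ) ^ 2) * ((i + 1 : ℕ) : ℝ) ^ 2)) := by linarith
    _ = Real.exp (-(8 * s / (K : ℝ) ^ 2)) * (2 * ∑ i ∈ Finset.range M, Real.exp (-(8 * s / (K : ℝ) ^ 2) * ((i + 1 : ℕ) : ℝ) ^ 2)) := by ring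
    _ ≤ Real.exp (-(8 * s / (K : ℝ) ^ 2)) * ((K : ℝ) * Real.sqrt (π / (8 * s))) := mul_le_mul_of_nonneg_left htail h0

/-- ★★ **THE MIXING BOUND FOR THE DIAGONAL OF THE CYCLE HEAT KERNEL**: `K⁻¹Σ_{k∈ℤ∕K} e^{−s(2−2cos(2πv(k)∕K))} ≤ 1∕K + e^{−8s∕K²}·√(π∕(8s))` for `s > 0`, every `K ≥ 1` — the zero mode
`1∕K` plus the Gaussian shells; the factor `e^{−8s∕K²}` records equidistribution beyond the mixing time `s ≳ K²`. [cite: King1986, (4.4) p.670, (4.35) p.674] -/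
theorem cycle_symbol_sum_le {s : ℝ} (hs : 0 < s) :
    (K : ℝ)⁻¹ * ∑ k : ZMod K, Real.exp (-(s * (2 - 2 * Real.cos (2 * π * (k.valMinAbs : ℝ) / K))))
      ≤ (K : ℝ)⁻¹ + Real.exp (-(8 * s / (K : ℝ) ^ 2)) * Real.sqrt (π / (8 * s)) := by
  have hK : (0 : ℝ) < K := by exact_mod_cast Nat.pos_of_ne_zero (NeZero.ne K)
  set φ : ℕ → ℝ := fun w => Real.exp (-(16 * s / (K : ℝ) ^ 2) * (w : ℝ) ^ 2) with hφ
  have h1 : ∑ k : ZMod K, Real.exp (-(s * (2 - 2 * Real.cos (2 * π * (k.valMinAbs : ℝ) / K)))) ≤ ∑ k : ZMod K, φ (k.valMinAbs.natAbs) :=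
    Finset.sum_le_sum fun k _ => exp_neg_mul_symbol_le hs.le k
  have h2 := sum_univ_absV_le (K := K) φ (fun w => (Real.exp_pos _).le)
  have hφ0 : φ 0 = 1 := by simp [hφ]
  rw [hφ0] at h2
  have h3 := two_mul_sum_exp_sixteen_le (K := K) hs (K / 2)
  have h4 : ∑ k : ZMod K, Real.exp (-(s * (2 - 2 * Real.cos (2 * π * (k.valMinAbs : ℝ) / K))))
      ≤ 1 + Real.exp (-(8 * s / (K : ℝ) ^ 2)) * ((K : ℝ) * Real.sqrt (π / (8 * s))) := by
    have : 2 * ∑ i ∈ Finset.range (K / 2), φ (i + 1) = 2 * ∑ i ∈ Finset.range (K / 2), Real.exp (-(16 * s / (K : ℝ) ^ 2) * ((i + 1 : ℕ) : ℝ) ^ 2) := by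
      simp [hφ]
    linarith
  calc (K : ℝ)⁻¹ * ∑ k : ZMod K, Real.exp (-(s * (2 - 2 * Real.cos (2 * π * (k.valMinAbs : ℝ) / K))))
      ≤ (K : ℝ)⁻¹ * (1 + Real.exp (-(8 * s / (K : ℝ) ^ 2)) * ((K : ℝ) * Real.sqrt (π / (8 * s)))) :=
        mul_le_mul_of_nonneg_left h4 (by positivity)
    _ = (K : ℝ)⁻¹ + Real.exp (-(8 * s / (K : ℝ) ^ 2)) * Real.sqrt (π / (8 * s)) := by field_simp

/-- The coarse form without the mixing factor: `K⁻¹Σ_k e^{−s(2−2cos(2πv(k)∕K))} ≤ 1∕K + √(π∕(8s))`. [cite: King1986, (4.4) p.670] -/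
theorem cycle_symbol_sum_le' {s : ℝ} (hs : 0 < s) :
    (K : ℝ)⁻¹ * ∑ k : ZMod K, Real.exp (-(s * (2 - 2 * Real.cos (2 * π * (k.valMinAbs : ℝ) / K))))
      ≤ (K : ℝ)⁻¹ + Real.sqrt (π / (8 * s)) := by
  refine (cycle_symbol_sum_le hs).trans (add_le_add le_rfl ?_)
  have h1 : Real.exp (-(8 * s / (K : ℝ) ^ 2)) ≤ 1 := by rw [Real.exp_le_one_iff]; exact neg_nonpos.mpr (by positivity)
  have h0 : 0 ≤ Real.sqrt (π / (8 * s)) := Real.sqrt_nonneg _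
  calc _ ≤ 1 * Real.sqrt (π / (8 * s)) := mul_le_mul_of_nonneg_right h1 h0
    _ = _ := one_mul _

/-- The trivial bound: `K⁻¹Σ_k e^{−s(2−2cos(2πv(k)∕K))} ≤ 1` (`s ≥ 0`). [folklore] -/
theorem cycle_symbol_sum_le_one {s : ℝ} (hs : 0 ≤ s) :
    (K : ℝ)⁻¹ * ∑ k : ZMod K, Real.exp (-(s * (2 - 2 * Real.cos (2 * π * (k.valMinAbs : ℝ) / K)))) ≤ 1 := by
  have hK : (0 : ℝ) < K := by exact_mod_cast Nat.pos_of_ne_zero (NeZero.ne K)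
  have h1 : ∑ k : ZMod K, Real.exp (-(s * (2 - 2 * Real.cos (2 * π * (k.valMinAbs : ℝ) / K)))) ≤ ∑ _k : ZMod K, (1 : ℝ) := by
    refine Finset.sum_le_sum fun k _ => ?_
    rw [Real.exp_le_one_iff, neg_nonpos]
    exact mul_nonneg hs (by linarith [Real.cos_le_one (2 * π * (k.valMinAbs : ℝ) / K)])
  rw [Finset.sum_const, Finset.card_univ, ZMod.card, nsmul_eq_mul, mul_one] at h1
  calc (K : ℝ)⁻¹ * ∑ k : ZMod K, Real.exp (-(s * (2 - 2 * Real.cos (2 * π * (k.valMinAbs : ℝ) / K)))) ≤ (K : ℝ)⁻¹ * K :=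
        mul_le_mul_of_nonneg_left h1 (by positivity)
    _ = 1 := inv_mul_cancel₀ hK.ne'

/-- ★★ **THE WINDOW BOUND**: `K⁻¹Σ_{k∈ℤ∕K} e^{−(8s∕K²)((|v(k)|−4)₊)²} ≤ 9∕K + √(π∕(8s))` for `s > 0` — the nine classes `|v| ≤ 4` cost `≤ 1` each, the rest is a Gaussian shell sum
(this is the Riemann sum of the window suprema of PART Ϣ-a's localised fourth derivative, step `2π∕K`, window length `4·2π∕K`). [cite: King1986, (4.4) p.670, (4.35) p.674] -/
theorem cycle_window_sum_le {s : ℝ} (hs : 0 < s) :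
    (K : ℝ)⁻¹ * ∑ k : ZMod K, Real.exp (-(8 * s / (K : ℝ) ^ 2) * (((k.valMinAbs.natAbs - 4 : ℕ) : ℝ)) ^ 2)
      ≤ 9 * (K : ℝ)⁻¹ + Real.sqrt (π / (8 * s)) := by
  have hK : (0 : ℝ) < K := by exact_mod_cast Nat.pos_of_ne_zero (NeZero.ne K)
  have ha : 0 < 8 * s / (K : ℝ) ^ 2 := by positivity
  set φ : ℕ → ℝ := fun w => Real.exp (-(8 * s / (K : ℝ) ^ 2) * (((w - 4 : ℕ) : ℝ)) ^ 2) with hφ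
  have hφ0 : ∀ w, 0 ≤ φ w := fun w => (Real.exp_pos _).le
  have hφ1 : ∀ w, φ w ≤ 1 := fun w => by
    simp only [hφ]; rw [Real.exp_le_one_iff, neg_mul, neg_nonpos]; positivity
  have h2 := sum_univ_absV_le (K := K) φ hφ0
  -- split the range at 4
  have hsplit : ∑ i ∈ Finset.range (K / 2), φ (i + 1) ≤ 4 + ∑ j ∈ Finset.range (K / 2 - 4), Real.exp (-(8 * s / (K : ℝ) ^ 2) * ((j + 1 : ℕ) : ℝ) ^ 2) := by
    by_cases hM : 4 ≤ K / 2
    · have e : K / 2 = 4 + (K / 2 - 4) := by omega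
      rw [e, Finset.sum_range_add, Nat.add_sub_cancel_left]
      have hA : ∑ i ∈ Finset.range 4, φ (i + 1) ≤ 4 := by
        calc ∑ i ∈ Finset.range 4, φ (i + 1) ≤ ∑ _i ∈ Finset.range 4, (1 : ℝ) := Finset.sum_le_sum fun i _ => hφ1 _
          _ = 4 := by simp
      have hB : ∑ j ∈ Finset.range (K / 2 - 4), φ (4 + j + 1) = ∑ j ∈ Finset.range (K / 2 - 4), Real.exp (-(8 * s / (K : ℝ) ^ 2) * ((j + 1 : ℕ) : ℝ) ^ 2) := by
        refine Finset.sum_congr rfl fun j _ => ?_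
        simp only [hφ]
        have : (4 + j + 1 - 4 : ℕ) = j + 1 := by omega
        rw [this]
      linarith [hA, hB.le, hB.ge]
    · push Not at hM
      have hA : ∑ i ∈ Finset.range (K / 2), φ (i + 1) ≤ 4 := by
        calc ∑ i ∈ Finset.range (K / 2), φ (i + 1) ≤ ∑ _i ∈ Finset.range (K / 2), (1 : ℝ) := Finset.sum_le_sum fun i _ => hφ1 _
          _ = (K / 2 : ℕ) := by simp
          _ ≤ 4 := by exact_mod_cast hM.le
      have hB : 0 ≤ ∑ j ∈ Finset.range (K / 2 - 4), Real.exp (-(8 * s / (K : ℝ) ^ 2) * ((j + 1 : ℕ) : ℝ) ^ 2) :=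
        Finset.sum_nonneg fun j _ => (Real.exp_pos _).le
      linarith
  have htail := two_mul_sum_range_exp_neg_mul_sq_succ_le ha (K / 2 - 4)
  have hsq : Real.sqrt (π / (8 * s / (K : ℝ) ^ 2)) = (K : ℝ) * Real.sqrt (π / (8 * s)) := by
    rw [show π / (8 * s / (K : ℝ) ^ 2) = (K : ℝ) ^ 2 * (π / (8 * s)) by field_simp]
    rw [Real.sqrt_mul (sq_nonneg _), Real.sqrt_sq hK.le]
  rw [hsq] at htail
  have hφz : φ 0 = 1 := by simp [hφ]
  rw [hφz] at h2
  have h4 : ∑ k : ZMod K, φ (k.valMinAbs.natAbs) ≤ 9 + (K : ℝ) * Real.sqrt (π / (8 * s)) := by linarith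
  calc (K : ℝ)⁻¹ * ∑ k : ZMod K, Real.exp (-(8 * s / (K : ℝ) ^ 2) * (((k.valMinAbs.natAbs - 4 : ℕ) : ℝ)) ^ 2)
      = (K : ℝ)⁻¹ * ∑ k : ZMod K, φ (k.valMinAbs.natAbs) := by rfl
    _ ≤ (K : ℝ)⁻¹ * (9 + (K : ℝ) * Real.sqrt (π / (8 * s))) := mul_le_mul_of_nonneg_left h4 (by positivity)
    _ = 9 * (K : ℝ)⁻¹ + Real.sqrt (π / (8 * s)) := by field_simp

end Summit.QuantumFields.YangMills.BalabanUVNodes.N15KingModelRung.HeatKernel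

end
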